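import Mathlib
import HarnessLib

/-!
# Hermite's quadratic form: a real polynomial is real-rooted iff its Hermite matrix is PSD

For a real polynomial `P`, the **Newton sums** `N_k(P) = Σ_{x ∈ Zer(P,ℂ)} μ(x) x^k` (Basu–Pollack–Roy,
*Algorithms in Real Algebraic Geometry*, Def. 4.7) and the **Hermite quadratic form**
`Her(P,1)(f₁,…,f_p) = Σ_{x ∈ Zer(P,ℂ)} μ(x) (f₁ + f₂x + ⋯ + f_p x^{p−1})²`, whose matrix in the basis
`1, X, …, X^{p−1}` is the Hankel matrix `Newt₀(P) = (N_{i+j})` of Newton sums (ibid., §4.3.2).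
**Hermite's theorem** (ibid., Thm. 4.57/4.58): `rank Her(P,1)` = number of distinct complex roots,
`sign Her(P,1)` = number of distinct real roots. This file proves the corollary used as a
*certificate of real-rootedness* (Sylvester / Hermite; C. Hanselka, J. Algebra 487 (2017),
Lemma 1.1 and Cor. 3.1 over `ℝ`: "`f` is real rooted iff the trace form — whose Gram matrix in the
power basis is the Hermite matrix — is positive semidefinite"):

* `newtonSumC`, `newtonSum`, `conj_newtonSumC`, `ofReal_newtonSum` — Newton sums (complex /
  real; they are real numbers);
* `hermiteMatrix P n = (N_{i+j}(P))_{0 ≤ i,j < n}` and the defining identity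
  `dotProduct_hermiteMatrix_mulVec`: `uᵀ Her u = Re Σ_{x ∈ Zer(P,ℂ)} μ(x) U(x)²`, `U = Σ uᵢ Xⁱ`;
* `posSemidef_hermiteMatrix_of_splits` — real-rooted ⇒ PSD (every `U(x)²` is a real square);
* `splits_of_posSemidef_hermiteMatrix` — PSD (any size `n ≥ deg P`) ⇒ real-rooted: for a
  non-real root `z`, the real interpolation polynomial with `U(z) = i`, `U(z̄) = −i`, `U = 0` at the
  other roots gives `Her(u,u) = −(μ(z) + μ(z̄)) < 0` (the sign computation in the proof of
  Thm. 4.57, ibid.);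
* `splits_iff_posSemidef_hermiteMatrix`.

The identification `N_{j+k} = Tr(L_{X^{j+k}})` with the trace form of `ℝ[X]/(P)` (ibid.,
Prop. 4.53/4.54) is not needed here and not formalized.

## References
* [BasuPollackRoy2006] S. Basu, R. Pollack, M.-F. Roy, Algorithms in Real Algebraic Geometry,
  2nd ed., Springer 2006: Def. 4.7 (Newton sums), §4.3.2 (Hermite's quadratic form),
  Thm. 4.57–4.58 (Hermite).
* [Hanselka2017] C. Hanselka, Characteristic polynomials of symmetric matrices over the univariate
  polynomial ring, J. Algebra 487 (2017) 340–356: Lemma 1.1 (Sylvester), Cor. 3.1.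
-/

noncomputable section

open Polynomial Finset Matrix
open scoped ComplexConjugate

namespace Literature.Algebra.Polynomial

/-! ### Newton sums -/

/-- The `k`-th **Newton sum** of a real polynomial `P`, `N_k(P) = Σ_{x ∈ Zer(P,ℂ)} μ(x) x^k`, the sum
over the complex roots counted with multiplicity, as a complex number (it is real:
`conj_newtonSumC`). [cite: BasuPollackRoy2006, Def. 4.7] -/
def newtonSumC (P : ℝ[X]) (k : ℕ) : ℂ := ((P.aroots ℂ).map fun x => x ^ k).sum

/-- The `k`-th **Newton sum** of a real polynomial as a real number.
[cite: BasuPollackRoy2006, Def. 4.7] -/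
def newtonSum (P : ℝ[X]) (k : ℕ) : ℝ := (newtonSumC P k).re

/-- Unfolding `newtonSumC`. [cite: BasuPollackRoy2006, Def. 4.7] -/
theorem newtonSumC_def (P : ℝ[X]) (k : ℕ) :
    newtonSumC P k = ((P.aroots ℂ).map fun x => x ^ k).sum := rfl

/-- Unfolding `newtonSum`. [cite: BasuPollackRoy2006, Def. 4.7] -/
theorem newtonSum_def (P : ℝ[X]) (k : ℕ) : newtonSum P k = (newtonSumC P k).re := rfl

/-- The complex roots of a real polynomial, with multiplicity, are permuted by complex
conjugation. [folklore] -/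
theorem map_conj_aroots (P : ℝ[X]) : (P.aroots ℂ).map conj = P.aroots ℂ := by
  have hmap : (P.map (algebraMap ℝ ℂ)).map (starRingEnd ℂ) = P.map (algebraMap ℝ ℂ) := by
    rw [Polynomial.map_map]
    congr 1
    ext x
    simp
  have hcard : (P.map (algebraMap ℝ ℂ)).roots.card = (P.map (algebraMap ℝ ℂ)).natDegree :=
    (IsAlgClosed.splits _).natDegree_eq_card_roots.symm
  have h := roots_map_of_injective_of_card_eq_natDegree (starRingEnd ℂ).injective hcard
  rw [hmap] at h
  exact h

/-- Newton sums of a real polynomial are real. [cite: BasuPollackRoy2006, §4.3.2] -/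
theorem conj_newtonSumC (P : ℝ[X]) (k : ℕ) : conj (newtonSumC P k) = newtonSumC P k := by
  rw [newtonSumC_def, map_multiset_sum, Multiset.map_map]
  conv_rhs => rw [← map_conj_aroots P, Multiset.map_map]
  refine congrArg _ (Multiset.map_congr rfl fun x _ => ?_)
  simp [map_pow]

/-- The real Newton sum coerced to `ℂ` is the complex one. [cite: BasuPollackRoy2006, Def. 4.7] -/
theorem ofReal_newtonSum (P : ℝ[X]) (k : ℕ) : (newtonSum P k : ℂ) = newtonSumC P k :=
  Complex.conj_eq_iff_re.mp (conj_newtonSumC P k)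

/-! ### The Hermite matrix and the Hermite quadratic form -/

/-- The **Hermite matrix** `Her(P,1) = Newt₀(P)` of size `n`: the Hankel matrix
`(N_{i+j}(P))_{0 ≤ i, j < n}` of Newton sums (for `n = deg P` it is the matrix of Hermite's
quadratic form in the basis `1, X, …, X^{p-1}`). [cite: BasuPollackRoy2006, §4.3.2] -/
def hermiteMatrix (P : ℝ[X]) (n : ℕ) : Matrix (Fin n) (Fin n) ℝ :=
  Matrix.of fun i j => newtonSum P ((i : ℕ) + j)

/-- Entries of the Hermite matrix. [cite: BasuPollackRoy2006, §4.3.2] -/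
theorem hermiteMatrix_apply (P : ℝ[X]) (n : ℕ) (i j : Fin n) :
    hermiteMatrix P n i j = newtonSum P ((i : ℕ) + j) := rfl

/-- The Hermite matrix is symmetric (Hankel). [cite: BasuPollackRoy2006, §4.3.2] -/
theorem hermiteMatrix_isSymm (P : ℝ[X]) (n : ℕ) : (hermiteMatrix P n).IsSymm := by
  ext i j
  simp [hermiteMatrix_apply, add_comm]

/-- The Hermite matrix is Hermitian (real symmetric). [cite: BasuPollackRoy2006, §4.3.2] -/
theorem hermiteMatrix_isHermitian (P : ℝ[X]) (n : ℕ) : (hermiteMatrix P n).IsHermitian := by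
  change (hermiteMatrix P n)ᴴ = hermiteMatrix P n
  rw [conjTranspose_eq_transpose_of_trivial]
  exact hermiteMatrix_isSymm P n

/-- The polynomial `U = Σ_{i<n} uᵢ Xⁱ` with coefficient vector `u`, evaluated over `ℂ`. [folklore] -/
theorem eval_map_sum_C_mul_X_pow {n : ℕ} (u : Fin n → ℝ) (x : ℂ) :
    ((∑ i : Fin n, C (u i) * X ^ (i : ℕ)).map (algebraMap ℝ ℂ)).eval x =
      ∑ i : Fin n, (u i : ℂ) * x ^ (i : ℕ) := by
  rw [Polynomial.map_sum, eval_finsetSum]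
  refine sum_congr rfl fun i _ => ?_
  simp

/-- Exchanging a multiset sum with a finite sum. [folklore] -/
theorem multiset_sum_map_finset_sum {ι α β : Type*} [AddCommMonoid β] (s : Multiset α)
    (t : Finset ι) (f : ι → α → β) :
    (s.map fun x => ∑ i ∈ t, f i x).sum = ∑ i ∈ t, (s.map fun x => f i x).sum := by
  classical
  induction t using Finset.induction_on with
  | empty => simp
  | insert a t ha ih => simp [Finset.sum_insert ha, Multiset.sum_map_add, ih]

/-- **Hermite's quadratic form** (defining identity): for `u ∈ ℝⁿ` and `U = Σ uᵢ Xⁱ`,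
`uᵀ Her(P) u = Re Σ_{x ∈ Zer(P,ℂ)} μ(x) U(x)²` (the sum itself is real).
[cite: BasuPollackRoy2006, §4.3.2 (definition of `Her(P,1)` and its matrix `Newt₀(P)`)] -/
theorem dotProduct_hermiteMatrix_mulVec (P : ℝ[X]) (n : ℕ) (u : Fin n → ℝ) :
    u ⬝ᵥ (hermiteMatrix P n *ᵥ u) =
      (((P.aroots ℂ).map fun x =>
        ((∑ i : Fin n, C (u i) * X ^ (i : ℕ)).map (algebraMap ℝ ℂ)).eval x ^ 2).sum).re := by
  -- left-hand side as the real part of a complex double sum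
  have hL : u ⬝ᵥ (hermiteMatrix P n *ᵥ u) =
      (∑ i : Fin n, ∑ j : Fin n, (u i : ℂ) * (u j : ℂ) * newtonSumC P ((i : ℕ) + j)).re := by
    simp only [dotProduct, mulVec, hermiteMatrix_apply, Complex.re_sum, mul_sum]
    refine sum_congr rfl fun i _ => sum_congr rfl fun j _ => ?_
    rw [← ofReal_newtonSum]
    simp only [← Complex.ofReal_mul, Complex.ofReal_re]
    ring
  rw [hL]
  congr 1
  -- expand the square and exchange summations
  simp_rw [eval_map_sum_C_mul_X_pow, sq, sum_mul_sum, newtonSumC_def]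
  simp only [multiset_sum_map_finset_sum, ← Multiset.sum_map_mul_left]
  refine sum_congr rfl fun i _ => sum_congr rfl fun j _ => ?_
  refine congrArg _ (Multiset.map_congr rfl fun x _ => ?_)
  ring

/-! ### Hermite's theorem: real-rootedness ⇔ the Hermite matrix is positive semidefinite -/

/-- **Real-rooted ⇒ Hermite matrix PSD** (Basu–Pollack–Roy Thm. 4.58, the easy half; Hanselka
2017 Cor. 3.1 "⇒" over `ℝ`): if `P` splits over `ℝ`, then `uᵀ Her(P) u = Σ_{x} μ(x) U(x)² ≥ 0`.
[cite: BasuPollackRoy2006, Thm. 4.58] [cite: Hanselka2017, Lemma 1.1 and Cor. 3.1] -/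
theorem posSemidef_hermiteMatrix_of_splits {P : ℝ[X]} (hP : P.Splits) (n : ℕ) :
    (hermiteMatrix P n).PosSemidef := by
  refine PosSemidef.of_dotProduct_mulVec_nonneg (hermiteMatrix_isHermitian P n) fun u => ?_
  rw [star_trivial, dotProduct_hermiteMatrix_mulVec]
  -- all complex roots are real
  have hroots : P.aroots ℂ = P.roots.map (algebraMap ℝ ℂ) :=
    (roots_map_of_injective_of_card_eq_natDegree (algebraMap ℝ ℂ).injective
      hP.natDegree_eq_card_roots.symm).symm
  rw [hroots, Multiset.map_map]
  set U : ℝ[X] := ∑ i : Fin n, C (u i) * X ^ (i : ℕ) with hU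
  have hfun : ((fun x : ℂ => ((U.map (algebraMap ℝ ℂ)).eval x) ^ 2) ∘ (algebraMap ℝ ℂ)) =
      fun r : ℝ => (((U.eval r) ^ 2 : ℝ) : ℂ) := by
    funext r
    simp only [Function.comp_apply]
    rw [eval_map, eval₂_hom]
    simp
  rw [hfun]
  have hsum := map_multiset_sum Complex.ofRealHom (P.roots.map fun r => (U.eval r) ^ 2)
  rw [Multiset.map_map] at hsum
  simp only [Complex.ofRealHom_eq_coe, Function.comp_def] at hsum
  rw [← hsum, Complex.ofReal_re]
  refine Multiset.sum_nonneg fun y hy => ?_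
  obtain ⟨r, _, rfl⟩ := Multiset.mem_map.mp hy
  exact sq_nonneg _

/-- A real polynomial all of whose complex roots are real splits over `ℝ`. [folklore] -/
theorem splits_of_forall_mem_aroots_im_eq_zero {P : ℝ[X]}
    (h : ∀ z ∈ P.aroots ℂ, z.im = 0) : P.Splits := by
  classical
  rw [splits_iff_card_roots]
  have hfilter := Polynomial.filter_roots_map_range_eq_map_roots (algebraMap ℝ ℂ).injective P
  have hall : ((P.map (algebraMap ℝ ℂ)).roots.filter (· ∈ (algebraMap ℝ ℂ).range)) =
      (P.map (algebraMap ℝ ℂ)).roots := by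
    refine Multiset.filter_eq_self.2 fun z hz => ?_
    exact ⟨z.re, Complex.ext (by simp) (by simp [h z hz])⟩
  rw [hall] at hfilter
  have hc := congrArg Multiset.card hfilter
  rw [Multiset.card_map, IsAlgClosed.card_roots_eq_natDegree, natDegree_map] at hc
  exact hc.symm

/-- Evaluating the conjugate polynomial. [folklore] -/
theorem eval_map_conj (p : ℂ[X]) (w : ℂ) :
    (p.map (starRingEnd ℂ)).eval w = conj (p.eval (conj w)) := by
  have h := Polynomial.eval₂_hom (starRingEnd ℂ) (conj w) (p := p)
  rw [Complex.conj_conj] at h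
  rw [eval_map]
  exact h

/-- **Hermite matrix PSD ⇒ real-rooted** (Basu–Pollack–Roy Thm. 4.57/4.58, the sign computation
for a pair of conjugate non-real roots; Hanselka 2017 Cor. 3.1 "⇐" over `ℝ`): if the Hermite matrix
of size `n ≥ deg P` of a non-zero real polynomial `P` is positive semidefinite, then all roots of
`P` are real. Proof as printed: for a non-real root `z`, the real polynomial `U` of degree `< n`
with `U(z) = i`, `U(z̄) = −i` and `U = 0` at the other roots has
`Her(u,u) = μ(z)·i² + μ(z̄)·(−i)² < 0`.
[cite: BasuPollackRoy2006, Thm. 4.57–4.58] [cite: Hanselka2017, Lemma 1.1 and Cor. 3.1] -/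
theorem splits_of_posSemidef_hermiteMatrix {P : ℝ[X]} {n : ℕ} (hn : P.natDegree ≤ n)
    (hpsd : (hermiteMatrix P n).PosSemidef) : P.Splits := by
  classical
  by_contra hns
  -- a non-real root `z`; its conjugate is a root as well
  have hz : ∃ z ∈ P.aroots ℂ, z.im ≠ 0 := by
    by_contra hall
    push Not at hall
    exact hns (splits_of_forall_mem_aroots_im_eq_zero hall)
  obtain ⟨z, hzmem, hzim⟩ := hz
  set S : Finset ℂ := (P.aroots ℂ).toFinset with hS
  have hmemS : ∀ w, w ∈ S ↔ w ∈ P.aroots ℂ := fun w => Multiset.mem_toFinset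
  have hconj_mem : ∀ w ∈ P.aroots ℂ, conj w ∈ P.aroots ℂ := by
    intro w hw
    rw [← map_conj_aroots P]
    exact Multiset.mem_map_of_mem _ hw
  have hzS : z ∈ S := (hmemS z).2 hzmem
  have hconjmem : conj z ∈ P.aroots ℂ := hconj_mem z hzmem
  have hzne : conj z ≠ z := fun h => hzim (Complex.conj_eq_iff_im.mp h)
  have hzne' : z ≠ conj z := fun h => hzne h.symm
  -- the interpolation polynomial `L` with `L(z) = i`, `L(conj z) = -i`, `L = 0` at the other roots
  set r : ℂ → ℂ := fun w => if w = z then Complex.I else if w = conj z then -Complex.I else 0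
    with hr
  set L : ℂ[X] := Lagrange.interpolate S id r with hL
  have hLdeg : L.degree < S.card := Lagrange.degree_interpolate_lt _ (Set.injOn_id _)
  have hLnode : ∀ w ∈ S, L.eval w = r w := by
    intro w hw
    have h := Lagrange.eval_interpolate_at_node r (Set.injOn_id (s := (S : Set ℂ))) hw
    simpa [hL] using h
  -- `L` has real coefficients
  have hrconj : ∀ w, conj (r (conj w)) = r w := by
    intro w
    by_cases h1 : w = z
    · subst h1
      simp [hr, hzne]
    · by_cases h2 : w = conj z
      · subst h2
        simp [hr, hzne]
      · have h3 : conj w ≠ z := fun h => h2 (by rw [← h, Complex.conj_conj])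
        have h4 : conj w ≠ conj z := fun h => h1 ((starRingEnd ℂ).injective h)
        simp [hr, h1, h2, h3, h4]
  have hLconj : L.map (starRingEnd ℂ) = L := by
    refine Polynomial.eq_of_degrees_lt_of_eval_finset_eq S (lt_of_le_of_lt degree_map_le hLdeg)
      hLdeg fun w hw => ?_
    have hcw : conj w ∈ S := (hmemS _).2 (hconj_mem w ((hmemS w).1 hw))
    rw [eval_map_conj, hLnode _ hcw, hLnode _ hw, hrconj w]
  have hlifts : L ∈ Polynomial.lifts (algebraMap ℝ ℂ) := by
    rw [lifts_iff_coeff_lifts]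
    intro k
    have hk : conj (L.coeff k) = L.coeff k := by
      conv_rhs => rw [← hLconj]
      rw [coeff_map]
    exact ⟨(L.coeff k).re, by simpa using Complex.conj_eq_iff_re.mp hk⟩
  obtain ⟨U, hUmap, hUdeg⟩ := Polynomial.exists_degree_eq_of_mem_lifts hlifts
  -- degree bookkeeping: `deg U = deg L < #S ≤ deg P ≤ n`
  have hScard : S.card ≤ n := by
    refine le_trans (Multiset.toFinset_card_le _) ((Polynomial.card_roots' _).trans ?_)
    rw [natDegree_map]
    exact hn
  have hnpos : 0 < n := lt_of_lt_of_le (Finset.card_pos.mpr ⟨z, hzS⟩) hScard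
  have hUnat : U.natDegree < n := by
    by_cases hU0 : U = 0
    · rw [hU0, natDegree_zero]
      exact hnpos
    · have hdegU : U.degree < n := by
        rw [hUdeg]
        exact lt_of_lt_of_le hLdeg (by exact_mod_cast hScard)
      exact (natDegree_lt_iff_degree_lt hU0).mpr hdegU
  -- the coefficient vector `u` of `U` and the value of the Hermite form at `u`
  set u : Fin n → ℝ := fun i => U.coeff i with hu
  have hUsum : (∑ i : Fin n, C (u i) * X ^ (i : ℕ)) = U := by
    simp_rw [hu, C_mul_X_pow_eq_monomial]
    rw [Fin.sum_univ_eq_sum_range (fun i => monomial i (U.coeff i)) n]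
    exact (Polynomial.as_sum_range' U n hUnat).symm
  have h0 : 0 ≤ u ⬝ᵥ (hermiteMatrix P n *ᵥ u) := by
    simpa using hpsd.dotProduct_mulVec_nonneg u
  rw [dotProduct_hermiteMatrix_mulVec, hUsum, hUmap] at h0
  -- `Σ_{x ∈ Zer(P,ℂ)} μ(x) L(x)² = -(μ(z) + μ(conj z))`
  have hval : ∀ x ∈ P.aroots ℂ, L.eval x ^ 2 =
      (if x = z then (-1 : ℂ) else 0) + (if x = conj z then (-1 : ℂ) else 0) := by
    intro x hx
    rw [hLnode x ((hmemS x).2 hx), hr]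
    by_cases h1 : x = z
    · subst h1
      simp [hzne', Complex.I_sq]
    · by_cases h2 : x = conj z
      · subst h2
        simp [hzne, Complex.I_sq]
      · simp [h1, h2]
  have hsum : ((P.aroots ℂ).map fun x => L.eval x ^ 2).sum =
      -(((P.aroots ℂ).count z : ℂ) + ((P.aroots ℂ).count (conj z) : ℂ)) := by
    rw [Multiset.map_congr rfl hval, Multiset.sum_map_add, Finset.sum_multiset_map_count,
      Finset.sum_multiset_map_count]
    simp only [smul_ite, smul_neg, smul_zero, Finset.sum_ite_eq', ← hS]
    rw [if_pos hzS, if_pos ((hmemS _).2 hconjmem)]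
    simp only [nsmul_eq_mul, mul_one]
    ring
  rw [hsum] at h0
  have hcz : 1 ≤ (P.aroots ℂ).count z := Multiset.one_le_count_iff_mem.mpr hzmem
  have hcz' : 1 ≤ (P.aroots ℂ).count (conj z) := Multiset.one_le_count_iff_mem.mpr hconjmem
  have hre : (-(((P.aroots ℂ).count z : ℂ) + ((P.aroots ℂ).count (conj z) : ℂ))).re =
      -(((P.aroots ℂ).count z : ℝ) + ((P.aroots ℂ).count (conj z) : ℝ)) := by
    simp
  rw [hre] at h0
  have h1 : (1 : ℝ) ≤ (P.aroots ℂ).count z := by exact_mod_cast hcz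
  have h2 : (1 : ℝ) ≤ (P.aroots ℂ).count (conj z) := by exact_mod_cast hcz'
  linarith

/-- **Hermite / Sylvester: a non-constant-normalised criterion of real-rootedness.** For a real
polynomial `P` and any `n ≥ deg P`: `P` splits over `ℝ` (all its roots are real) iff its Hermite
matrix `(N_{i+j}(P))_{i,j<n}` is positive semidefinite (Basu–Pollack–Roy Thm. 4.58: the signature of
`Her(P,1)` is the number of distinct real roots, its rank the number of distinct complex roots;
Hanselka 2017, Lemma 1.1/Cor. 3.1 over `ℝ`).
[cite: BasuPollackRoy2006, Thm. 4.57–4.58] [cite: Hanselka2017, Lemma 1.1 and Cor. 3.1] -/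
theorem splits_iff_posSemidef_hermiteMatrix {P : ℝ[X]} {n : ℕ} (hn : P.natDegree ≤ n) :
    P.Splits ↔ (hermiteMatrix P n).PosSemidef :=
  ⟨fun h => posSemidef_hermiteMatrix_of_splits h n, splits_of_posSemidef_hermiteMatrix hn⟩

end Literature.Algebra.Polynomial
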